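import Summits.RiemannHypothesis.RiemannHypothesis.Theorems.ScrewManifestCornerLaw
import Summits.RiemannHypothesis.RiemannHypothesis.Theorems.ScrewManifestCornerGap
import Summits.RiemannHypothesis.RiemannHypothesis.Theorems.ScrewManifestCornerPrelims
import Summits.RiemannHypothesis.RiemannHypothesis.Theorems.ScrewManifestLagDensity
import HarnessLib

/-!
# RH-FREE: the assembly `CornerGap → LagDensity → CornerCostLaw` (and hence `CornerGap → PlateauBound → SuperlinearFloor`)

sos-theory's reduction of the corner cost law S1 (`Manifest.CornerCostLaw`, `ScrewManifestCornerLaw`) to the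
slots of `ScrewManifestCornerGap` (note SCREW-P3-FOLD-NOTE-g19 §2, ASSEMBLY), carried out in the tree:

* `cornerCostLaw_of_cornerGap : CornerGap → LagDensity → CornerCostLaw`;
* with `lagDensity_holds` (`ScrewManifestLagDensity`) and `superlinearFloor_of_cornerCostLaw`:
  `superlinearFloor_of_cornerGap : CornerGap → PlateauBound → SuperlinearFloor`.

So the superlinear floor of manifest certificates is reduced to the analytic corner gap L2 (`CornerGap`:
no nonnegative band-limited cosine-atom sum is uniformly close to `s/2` on a dense subset of `[1,3]`) and
the plateau bound S2 (`PlateauBound`).  L1 (`CuspBound`) is not even needed as a hypothesis: the uniform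
scaled cusp `|M·Ψ(s/M) − (s/2)·log M| ≤ 15` (`ScrewManifestCornerPrelims.abs_mul_zetaScrew_div_sub_le`) is a
tree theorem.

Proof of the assembly (contrapositive, `N = n + 1` large; small `N` by the top row and the choice of `C`):
if every row had DD-deficit `< X = (c·log N − C)/N`, then on the top half `−X < R_ii ≤ A/N` and every
off-diagonal entry has `|R_ij| < R_ii + X`; by `remainder_offdiag_eq` (the all-ones weight cancels)
`|N·η(node i − node j)| ≤ 3|A| + 2(c·log N − C)` for top-half pairs, `η = Ψ − atoms`.  At a scaled near lag
`s = N(node i − node j) ∈ [1,3]` this says that the RESCALED atom sum `Φ̃(s) = Σ_k (w_k/(N log N))·(1 − cos(τ_k s))/τ_k²`,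
`τ_k = t_k/N ≤ θ`, satisfies `|Φ̃(s) − s/2| ≤ (15 + 3|A| + 2(c log N − C))/log N ≤ 2c = ε/2` (choice
`c = ε/4`, `2C ≥ 3|A| + 15`), at every point of the set `P` of scaled near lags in `[1,3]`, which is
`δ`-dense by `LagDensity` (applied at `min δ 1 / 2` to a clamped target) — contradicting `CornerGap`.

RH-FREE: statements about the certificate FORMAT for truncated screw matrices; nothing here bears on the
truth of RH.  References: [folklore]; the plan is sos-theory's (HOME/sos/theory/SCREW-P3-FOLD-NOTE-g19.md §2).
-/

set_option linter.dupNamespace false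
set_option autoImplicit false

noncomputable section

open Real Set Finset

namespace Summit.RiemannHypothesis.RiemannHypothesis.Theorems.IntegerScrew.Manifest

open Literature.NumberTheory.LFunctions

set_option maxHeartbeats 400000 in
/-- **ASSEMBLY (RH-free): the corner gap and the lag density imply the corner cost law.** [folklore] -/
theorem cornerCostLaw_of_cornerGap (h2 : CornerGap) (h3 : LagDensity) : CornerCostLaw := by
  classical
  intro θ A hθ
  obtain ⟨ε, δ, hε, hδ, hgap⟩ := h2 θ hθ
  -- density at the scale `δ' / 2`, `δ' = min δ 1`
  set δ' : ℝ := min δ 1 with hδ'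
  have hδ'0 : 0 < δ' := lt_min hδ one_pos
  have hδ'δ : δ' ≤ δ := min_le_left _ _
  have hδ'1 : δ' ≤ 1 := min_le_right _ _
  obtain ⟨M₀, hM₀⟩ := h3 (δ' / 2) (by positivity)
  -- the constants
  set N₁ : ℕ := max M₀ 8 with hN₁
  have hN₁8 : 8 ≤ N₁ := le_max_right _ _
  set c : ℝ := ε / 4 with hc
  have hc0 : 0 < c := by positivity
  set C : ℝ := (3 * |A| + 15) / 2 + c * Real.log N₁ + |A| with hC
  have hlogN₁ : 0 ≤ Real.log (N₁ : ℝ) := Real.log_nonneg (by exact_mod_cast le_trans (by norm_num) hN₁8)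
  have hC2 : 3 * |A| + 15 ≤ 2 * C := by
    have := abs_nonneg A
    have : 0 ≤ c * Real.log N₁ := mul_nonneg hc0.le hlogN₁
    linarith
  refine ⟨c, C, hc0, ?_⟩
  intro n K t w wJ hn hatoms hwJ hdiag
  set R := remainder n K t w wJ with hR
  have hN0 : (0 : ℝ) < (n : ℝ) + 1 := by positivity
  by_cases hsmall : n + 1 < N₁
  · -- small `N`: the top row, by the choice of `C`
    have hi : n - 1 < n := by omega
    refine ⟨⟨n - 1, hi⟩, ?_⟩
    have hd := hdiag ⟨n - 1, hi⟩ (by show n ≤ 4 * (n - 1 + 2); omega)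
    have hsum : 0 ≤ ∑ j ∈ univ.erase (⟨n - 1, hi⟩ : Fin n), |R ⟨n - 1, hi⟩ j| :=
      sum_nonneg fun _ _ => abs_nonneg _
    have hlogN : Real.log ((n : ℝ) + 1) ≤ Real.log N₁ :=
      Real.log_le_log hN0 (by exact_mod_cast hsmall.le)
    have hcl : c * Real.log ((n : ℝ) + 1) ≤ c * Real.log N₁ := mul_le_mul_of_nonneg_left hlogN hc0.le
    have hkey : c * Real.log ((n : ℝ) + 1) - C ≤ -A := by
      have := le_abs_self A
      have := abs_nonneg A
      linarith
    calc (c * Real.log ((n : ℝ) + 1) - C) / ((n : ℝ) + 1) ≤ -A / ((n : ℝ) + 1) :=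
          div_le_div_of_nonneg_right hkey hN0.le
      _ ≤ (∑ j ∈ univ.erase (⟨n - 1, hi⟩ : Fin n), |R ⟨n - 1, hi⟩ j|) - R ⟨n - 1, hi⟩ ⟨n - 1, hi⟩ := by
          rw [neg_div]; linarith
  · -- large `N`: contradiction with the corner gap
    push Not at hsmall
    have hM₀n : M₀ ≤ n + 1 := le_trans (le_max_left _ _) hsmall
    have h8 : 8 ≤ n + 1 := le_trans hN₁8 hsmall
    set N : ℝ := (n : ℝ) + 1 with hN
    have hN8 : (8 : ℝ) ≤ N := by rw [hN]; exact_mod_cast h8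
    set L := Real.log N with hL
    have hL0 : 0 < L := Real.log_pos (by linarith)
    by_contra hall
    push Not at hall
    -- consequences of «every deficit < X» on the top half
    set X := (c * L - C) / N with hX
    have hRii_lo : ∀ i : Fin n, -X < R i i := by
      intro i
      have h1 := hall i
      have h2 : 0 ≤ ∑ j ∈ univ.erase i, |R i j| := sum_nonneg fun _ _ => abs_nonneg _
      linarith
    have hRij : ∀ i j : Fin n, j ≠ i → |R i j| < R i i + X := by
      intro i j hji
      have h1 : |R i j| ≤ ∑ j' ∈ univ.erase i, |R i j'| :=
        single_le_sum (f := fun j' => |R i j'|) (fun _ _ => abs_nonneg _) (mem_erase.mpr ⟨hji, mem_univ _⟩)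
      linarith [hall i]
    have hRii_hi : ∀ i : Fin n, N ≤ 2 * (((i : ℕ) : ℝ) + 2) → R i i ≤ A / N := by
      intro i hi
      refine hdiag i ?_
      have h1 : (n : ℝ) ≤ 4 * ((i : ℕ) : ℝ) + 8 := by rw [hN] at hi; linarith
      have h2 : n ≤ 4 * (i : ℕ) + 8 := by exact_mod_cast h1
      omega
    -- the profile at top-half pairs: `|N·η(node i − node j)| ≤ 3|A| + 2(cL − C)`
    have hη : ∀ i j : Fin n, N ≤ 2 * (((j : ℕ) : ℝ) + 2) → (j : ℕ) < (i : ℕ) →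
        |N * remainderFn K t w (node n i - node n j)| ≤ 3 * |A| + 2 * (c * L - C) := by
      intro i j hj hij
      have hi' : N ≤ 2 * (((i : ℕ) : ℝ) + 2) := by
        have : ((j : ℕ) : ℝ) ≤ ((i : ℕ) : ℝ) := by exact_mod_cast hij.le
        linarith
      have hji : j ≠ i := fun h => by rw [h] at hij; exact lt_irrefl _ hij
      have e := remainder_offdiag_eq n K t w wJ i j
      rw [← hR] at e
      have h1 := hRii_hi i hi'
      have h2 := hRii_hi j hj
      have h3 := hRii_lo i
      have h4 := hRii_lo j
      have h5 := hRij i j hji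
      -- scale by `N`
      have hηeq : N * remainderFn K t w (node n i - node n j)
          = (N * R i i + N * R j j) / 2 - N * R i j := by rw [e]; ring
      rw [hηeq, abs_le]
      have hNX : N * X = c * L - C := by rw [hX]; field_simp
      have hA := le_abs_self A
      have hA' := neg_abs_le A
      have g1 : N * R i i ≤ A := by
        have := mul_le_mul_of_nonneg_left h1 hN0.le
        have e1 : N * (A / N) = A := by field_simp
        linarith
      have g2 : N * R j j ≤ A := by
        have := mul_le_mul_of_nonneg_left h2 hN0.le
        have e1 : N * (A / N) = A := by field_simp
        linarith
      have g3 : -(c * L - C) < N * R i i := by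
        have := mul_lt_mul_of_pos_left h3 hN0
        have e1 : N * (-X) = -(c * L - C) := by rw [← hNX]; ring
        linarith
      have g4 : -(c * L - C) < N * R j j := by
        have := mul_lt_mul_of_pos_left h4 hN0
        have e1 : N * (-X) = -(c * L - C) := by rw [← hNX]; ring
        linarith
      have g5 : N * |R i j| < N * R i i + (c * L - C) := by
        have := mul_lt_mul_of_pos_left h5 hN0
        have e1 : N * (R i i + X) = N * R i i + (c * L - C) := by rw [← hNX]; ring
        linarith
      have g6 : |N * R i j| = N * |R i j| := by rw [abs_mul, abs_of_pos hN0]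
      have g7 := le_abs_self (N * R i j)
      have g8 := neg_abs_le (N * R i j)
      have g9 : 0 ≤ N * |R i j| := by positivity
      constructor
      · linarith
      · linarith
    -- the rescaled atoms
    set τ : Fin K → ℝ := fun k => t k / N with hτ
    set W : Fin K → ℝ := fun k => w k / (N * L) with hW
    have hτW : ∀ k, 0 < τ k ∧ τ k ≤ θ ∧ 0 ≤ W k := by
      intro k
      obtain ⟨ht0, htθ, hw0⟩ := hatoms k
      refine ⟨by positivity, ?_, by positivity⟩
      show t k / N ≤ θ
      rw [div_le_iff₀ hN0, hN]; linarith
    -- the point set `P` of scaled near lags in `[1, 3]`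
    set lag : Fin n × Fin n → ℝ := fun q => N * (node n q.1 - node n q.2) with hlag
    set S : Finset (Fin n × Fin n) := univ.filter (fun q =>
      N ≤ 2 * (((q.2 : ℕ) : ℝ) + 2) ∧ (q.2 : ℕ) < (q.1 : ℕ) ∧ 1 ≤ lag q ∧ lag q ≤ 3) with hS
    set P : Finset ℝ := S.image lag with hP
    have hP1 : ∀ p ∈ P, 1 ≤ p ∧ p ≤ 3 := by
      intro p hp
      obtain ⟨q, hq, rfl⟩ := mem_image.mp hp
      have h := (mem_filter.mp hq).2
      exact ⟨h.2.2.1, h.2.2.2⟩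
    have hP2 : ∀ x : ℝ, 1 ≤ x → x ≤ 3 → ∃ p ∈ P, |x - p| ≤ δ := by
      intro x hx1 hx3
      -- clamp `x` into `[1 + δ'/2, 3 − δ'/2]`
      set x' : ℝ := max (1 + δ' / 2) (min x (3 - δ' / 2)) with hx'
      have hx'1 : 1 + δ' / 2 ≤ x' := le_max_left _ _
      have hx'3 : x' ≤ 3 - δ' / 2 := max_le (by linarith) (min_le_right _ _)
      have hxx' : |x - x'| ≤ δ' / 2 := by
        rw [abs_le]
        constructor
        · have : x' ≤ x + δ' / 2 := max_le (by linarith) (le_trans (min_le_left _ _) (by linarith))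
          linarith
        · have : x - δ' / 2 ≤ x' :=
            le_trans (le_min (by linarith) (by linarith)) (le_max_right _ _)
          linarith
      obtain ⟨i, j, hj, hij, _, hclose⟩ := hM₀ n hM₀n x' (by linarith) (by linarith)
      rw [← hN] at hj hclose
      have hlagij : lag (i, j) = N * (node n i - node n j) := rfl
      obtain ⟨hc1, hc2⟩ := abs_le.mp hclose
      have hmem : (i, j) ∈ S := by
        rw [hS, mem_filter]
        refine ⟨mem_univ _, hj, hij, ?_, ?_⟩
        · rw [hlagij]; linarith
        · rw [hlagij]; linarith
      refine ⟨lag (i, j), mem_image.mpr ⟨(i, j), hmem, rfl⟩, ?_⟩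
      rw [hlagij]
      have t1 := abs_sub_le x x' (N * (node n i - node n j))
      linarith
    -- the corner gap yields a bad point, which is a scaled near lag of a top-half pair
    obtain ⟨s, hsP, hsε⟩ := hgap K τ W P hτW hP1 hP2
    obtain ⟨⟨i, j⟩, hq, hs⟩ := mem_image.mp hsP
    obtain ⟨hj, hij, hs1, hs3⟩ := (mem_filter.mp hq).2
    rw [hs] at hs1 hs3
    have hlagij : lag (i, j) = N * (node n i - node n j) := rfl
    rw [hlagij] at hs
    set u := node n i - node n j with hu
    -- `Φ̃(s) = (N/L)·(Ψ(u) − η(u))`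
    have hΦ : (∑ k, W k * (1 - Real.cos (τ k * s)) / (τ k) ^ 2)
        = N / L * (zetaScrew u - remainderFn K t w u) := by
      have hatoms' : zetaScrew u - remainderFn K t w u
          = ∑ k, w k * ((1 - Real.cos (t k * u)) / t k ^ 2) := by
        simp only [remainderFn]; ring
      rw [hatoms', mul_sum]
      refine sum_congr rfl fun k _ => ?_
      have htk : t k ≠ 0 := (hatoms k).1.ne'
      have e1 : τ k * s = t k * u := by
        show t k / N * s = t k * u
        rw [← hs]; field_simp
      rw [e1]
      show w k / (N * L) * (1 - Real.cos (t k * u)) / (t k / N) ^ 2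
        = N / L * (w k * ((1 - Real.cos (t k * u)) / t k ^ 2))
      field_simp
    -- the bound `|Φ̃(s) − s/2| ≤ (15 + 3|A| + 2(cL − C))/L ≤ 2c < ε`
    have hcusp : |N * zetaScrew (s / N) - s / 2 * L| ≤ 15 :=
      abs_mul_zetaScrew_div_sub_le hs1 hs3 (by linarith)
    have hsu : s / N = u := by rw [← hs]; field_simp
    rw [hsu] at hcusp
    have hηb := hη i j hj hij
    have e2 : (∑ k, W k * (1 - Real.cos (τ k * s)) / (τ k) ^ 2) - s / 2
        = ((N * zetaScrew u - s / 2 * L) - N * remainderFn K t w u) / L := by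
      rw [hΦ]; field_simp; ring
    rw [e2, abs_div, abs_of_pos hL0] at hsε
    have e3 : |(N * zetaScrew u - s / 2 * L) - N * remainderFn K t w u|
        ≤ 15 + (3 * |A| + 2 * (c * L - C)) := by
      have := abs_sub (N * zetaScrew u - s / 2 * L) (N * remainderFn K t w u)
      linarith
    have e4 : ε ≤ (15 + (3 * |A| + 2 * (c * L - C))) / L :=
      le_trans hsε (div_le_div_of_nonneg_right e3 hL0.le)
    rw [le_div_iff₀ hL0] at e4
    -- `ε L ≤ 15 + 3|A| − 2C + 2cL ≤ (ε/2) L`: contradiction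
    have e5 : 2 * (c * L) = ε / 2 * L := by rw [hc]; ring
    have e6 : 0 < ε * L := mul_pos hε hL0
    linarith

/-- **Corollary (RH-free): the superlinear floor of manifest certificates is reduced to the corner gap (L2)
and the plateau bound (S2).** [folklore] -/
theorem superlinearFloor_of_cornerGap (h2 : CornerGap) (hS2 : PlateauBound) : SuperlinearFloor :=
  superlinearFloor_of_cornerCostLaw (cornerCostLaw_of_cornerGap h2 lagDensity_holds) hS2

end Summit.RiemannHypothesis.RiemannHypothesis.Theorems.IntegerScrew.Manifest

end
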